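import Mathlib
import HarnessLib
import Summits.Ventures.LatticeQCDFlow.Scaling.AutoregressiveGaugeAllClosingHeatBath
import Summits.Ventures.LatticeQCDFlow.Scoring.FlowSamplerAutocorrelation

/-!
# LatticeQCDFlow / Scaling — the exact sampler of the ALL-CLOSING-PLAQUETTES heat-bath autoregression:
# Doeblin, `τ_int ≤ K − 1/2` with `K = ∏_ℓ c_{#Cℓ}/(m^{#Cℓ−1}·c) ≤ (M/m)^{Σ_ℓ (#Cℓ − 1)}`

HONEST FRAMING: exact (Metropolis-corrected) sampling algorithms for lattice gauge theory;
figures of merit are autocorrelation/cost numbers at stated couplings and volumes; no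
continuum-physics claim.

Venture `LatticeQCDFlow` (cell pub-lqcd), topic `Scaling`, FANOUT row 30 (lean-1, GEN-27) — OUR WORK on
THEORY-2.md §4 row C5 (gen26 README (4), the scorecard of the richer conditioner).
`AutoregressiveGaugeAllClosingHeatBath` made the all-closing autoregression a normalised proposal
`q = (∏_ℓ q_ℓ)·Haar^{⊗E}` with importance ratio `π/q = ∏_ℓ N_ℓ(U)/Z` and
`m^{#Cℓ−1}·c ≤ N_ℓ(U) ≤ c_{#Cℓ}`.  Here GEN-24's scorecard route
(`Scoring.indepMH_autocorrelation_of_density_ratio`) for its exact sampler, the independence Metropolis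
chain with proposal `q` and target `π = (F/Z)·Haar^{⊗E}`:

* **`allClosing_autocorrelation`** — with `K := ∏_{ℓ∈T} c_{#Cℓ}/(m^{#Cℓ−1}·c)` (every `C ℓ` non-empty, the
  closing sets partitioning the plaquettes): the density ratio `ρ = Z/∏_ℓ N_ℓ` oscillates by at most `K`, so
  every bounded centred observable has `|C_f(t)| ≤ (1 − K⁻¹)^t ∫ f² dπ` and `τ_int(f) ≤ K − 1/2`;
* **`allClosing_constant_le`** — `K ≤ (M/m)^{Σ_ℓ (#Cℓ − 1)}` (`c_j ≤ M^{j−1}·c`): for a maximally closing order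
  (`Σ_ℓ (#Cℓ − 1) = k_min(d, L)`, `TorusClosingLinks`) the all-closing sampler's ceiling is never worse than
  the optimal one-plaquette sampler's `(M/m)^{k_min} − 1/2` of GEN-25, and strictly better in the base
  whenever some link closes two plaquettes and `w` is not constant (`PlaquetteManyWeightConstant.integral_pow_lt`).

NOT CLAIMED: a FLOOR (slowness) for this sampler — its cold-configuration analysis needs a bound
`N_ℓ(U) ≤ θ·c_{#Cℓ}` off a null set of earlier links (the staple-mismatch analogue of GEN-26's two-plaquette
constant), which is open.  No `def`, no `sorry`, nothing cited as a fact beyond the tree.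
-/

noncomputable section

namespace Summit.Ventures.LatticeQCDFlow.Theory2.Autoregressive

open MeasureTheory ProbabilityTheory Function Finset Filter
open scoped ENNReal Topology
open Literature.MathematicalPhysics.QuantumFieldTheory Literature.MathematicalPhysics.QuantumLattice
open Summit.Ventures.LatticeQCDFlow.Exactness Summit.Ventures.LatticeQCDFlow.Scoring

variable {d L : ℕ} [NeZero L] {G : Type*} [Group G] [TopologicalSpace G] [IsTopologicalGroup G]
  [CompactSpace G] [SecondCountableTopology G] [MeasurableSpace G] [BorelSpace G]

omit [NeZero L] [SecondCountableTopology G] in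
/-- **`K ≤ (M/m)^{Σ_ℓ (#Cℓ − 1)}`** for the all-closing constant `K = ∏_ℓ c_{#Cℓ}/(m^{#Cℓ−1}·c)` (every `C ℓ`
non-empty; `c_j ≤ M^{j−1}·c`). [ours] -/
theorem allClosing_constant_le {w : G → ℝ} (hw : Continuous w) {m M : ℝ} (hm0 : 0 < m) (hm : ∀ g, m ≤ w g)
    (hM : ∀ g, w g ≤ M) (T : Finset (Edge d L)) (C : Edge d L → Finset (Plaquette d L))
    (hCne : ∀ ℓ ∈ T, (C ℓ).Nonempty) :
    (∏ ℓ ∈ T, (∫ h, w h ^ (C ℓ).card ∂(haarProbability G)) /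
        (m ^ ((C ℓ).card - 1) * ∫ g, w g ∂(haarProbability G))) ≤
      (M / m) ^ (∑ ℓ ∈ T, ((C ℓ).card - 1)) := by
  have hw0 : ∀ g, 0 < w g := fun g => hm0.trans_le (hm g)
  have hMpos : 0 < M := (hw0 1).trans_le (hM 1)
  have hc : 0 < ∫ g, w g ∂(haarProbability G) := haarProbability_integral_pos_of_continuous_pos hw hw0
  rw [← Finset.prod_pow_eq_pow_sum]
  refine Finset.prod_le_prod (fun ℓ _ => div_nonneg (integral_nonneg fun h => pow_nonneg (hw0 h).le _)
    (mul_nonneg (pow_nonneg hm0.le _) hc.le)) fun ℓ hℓ => ?_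
  obtain ⟨n, hn⟩ : ∃ n, (C ℓ).card = n + 1 :=
    ⟨(C ℓ).card - 1, (Nat.succ_pred_eq_of_pos (Finset.card_pos.2 (hCne ℓ hℓ))).symm⟩
  rw [hn, Nat.add_sub_cancel, div_le_iff₀ (mul_pos (pow_pos hm0 _) hc), div_pow,
    div_mul_eq_mul_div, le_div_iff₀ (pow_pos hm0 _)]
  calc (∫ h, w h ^ (n + 1) ∂(haarProbability G)) * m ^ n
      ≤ (M ^ n * ∫ g, w g ∂(haarProbability G)) * m ^ n :=
        mul_le_mul_of_nonneg_right (integral_pow_le hw (fun g => (hw0 g).le) hM n) (pow_nonneg hm0.le _)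
    _ = M ^ n * (m ^ n * ∫ g, w g ∂(haarProbability G)) := by ring

/-- **THE ALL-CLOSING EXACT SAMPLER: DOEBLIN AND `τ_int ≤ K − 1/2`.**  `L ≥ 2`; `w` continuous, `0 < m ≤ w ≤ M`;
`T`, `pos`, `C` a closing assignment (each `C ℓ` non-empty, its plaquettes contain `ℓ` and have their other links
at smaller positions) whose closing sets PARTITION the plaquettes; `π = (F/Z)·Haar^{⊗E}` the target and
`q = (∏_ℓ q_ℓ)·Haar^{⊗E}` the all-closing proposal (both probability measures, the latter by
`integral_prod_allClosing_conditioner_eq_one`).  With `K = ∏_{ℓ∈T} c_{#Cℓ}/(m^{#Cℓ−1}·c)`, for the exact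
sampler `indepMH q (1/ρ)`, `ρ = Z/∏_ℓ N_ℓ`: every bounded measurable `π`-centred `f` has
`|C_f(t)| ≤ (1 − K⁻¹)^t ∫ f² dπ` for all `t` and `τ_int(f) ≤ K − 1/2`. [ours] -/
theorem allClosing_autocorrelation (hL : 2 ≤ L) {w : G → ℝ} (hw : Continuous w) {m M : ℝ} (hm0 : 0 < m)
    (hm : ∀ g, m ≤ w g) (hM : ∀ g, w g ≤ M) (T : Finset (Edge d L)) (C : Edge d L → Finset (Plaquette d L))
    (hCne : ∀ ℓ ∈ T, (C ℓ).Nonempty)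
    (hCe : ∀ ℓ ∈ T, ∀ p ∈ C ℓ, ℓ ∈ ({(p.1, p.2.1.1), (p.1.shift p.2.1.1, p.2.1.2),
        (p.1.shift p.2.1.2, p.2.1.1), (p.1, p.2.1.2)} : Finset (Edge d L)))
    (hdisj : ∀ ℓ ∈ T, ∀ ℓ' ∈ T, ℓ ≠ ℓ' → Disjoint (C ℓ) (C ℓ'))
    (hcover : ∀ p : Plaquette d L, ∃ ℓ ∈ T, p ∈ C ℓ)
    (π q : Measure (GaugeConfig d L G)) [IsProbabilityMeasure π] [IsProbabilityMeasure q]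
    (hπ : π = (Measure.pi fun _ : Edge d L => haarProbability G).withDensity fun U =>
      ENNReal.ofReal ((∏ p : Plaquette d L, w (plaquetteHolonomy U p.1 p.2.1.1 p.2.1.2)) /
        ∫ V, ∏ p : Plaquette d L, w (plaquetteHolonomy V p.1 p.2.1.1 p.2.1.2) ∂(Measure.pi fun _ : Edge d L => haarProbability G)))
    (hq : q = (Measure.pi fun _ : Edge d L => haarProbability G).withDensity fun U =>
      ENNReal.ofReal (∏ ℓ ∈ T, (∏ p ∈ C ℓ, w (plaquetteHolonomy U p.1 p.2.1.1 p.2.1.2)) /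
          (∫ v, ∏ p ∈ C ℓ, w (plaquetteHolonomy (update U ℓ v) p.1 p.2.1.1 p.2.1.2) ∂(haarProbability G))))
    {f : GaugeConfig d L G → ℝ} (hf : Measurable f) {Cf : ℝ} (hCf : ∀ x, |f x| ≤ Cf)
    (hf0 : ∫ U, f U ∂π = 0) :
    (∀ t : ℕ, |autocov (indepMH q fun U => (((∫ V, ∏ p : Plaquette d L, w (plaquetteHolonomy V p.1 p.2.1.1 p.2.1.2) ∂(Measure.pi fun _ : Edge d L => haarProbability G)) /
          ∏ ℓ ∈ T, (∫ v, ∏ p ∈ C ℓ, w (plaquetteHolonomy (update U ℓ v) p.1 p.2.1.1 p.2.1.2) ∂(haarProbability G))))⁻¹) π f t| ≤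
        (1 - ((∏ ℓ ∈ T, (∫ h, w h ^ (C ℓ).card ∂(haarProbability G)) /
        (m ^ ((C ℓ).card - 1) * ∫ g, w g ∂(haarProbability G))))⁻¹) ^ t * ∫ x, f x ^ 2 ∂π) ∧
      tauInt (fun t => autocov (indepMH q fun U => (((∫ V, ∏ p : Plaquette d L, w (plaquetteHolonomy V p.1 p.2.1.1 p.2.1.2) ∂(Measure.pi fun _ : Edge d L => haarProbability G)) /
          ∏ ℓ ∈ T, (∫ v, ∏ p ∈ C ℓ, w (plaquetteHolonomy (update U ℓ v) p.1 p.2.1.1 p.2.1.2) ∂(haarProbability G))))⁻¹) π f t /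
          autocov (indepMH q fun U => (((∫ V, ∏ p : Plaquette d L, w (plaquetteHolonomy V p.1 p.2.1.1 p.2.1.2) ∂(Measure.pi fun _ : Edge d L => haarProbability G)) /
          ∏ ℓ ∈ T, (∫ v, ∏ p ∈ C ℓ, w (plaquetteHolonomy (update U ℓ v) p.1 p.2.1.1 p.2.1.2) ∂(haarProbability G))))⁻¹) π f 0) ≤
        (∏ ℓ ∈ T, (∫ h, w h ^ (C ℓ).card ∂(haarProbability G)) /
        (m ^ ((C ℓ).card - 1) * ∫ g, w g ∂(haarProbability G))) - 1 / 2 := by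
  set Haar : Measure (GaugeConfig d L G) := (Measure.pi fun _ : Edge d L => haarProbability G) with hHaar
  set FT : GaugeConfig d L G → ℝ := fun U => ∏ p : Plaquette d L, w (plaquetteHolonomy U p.1 p.2.1.1 p.2.1.2) with hFT
  set NP : GaugeConfig d L G → ℝ := fun U => ∏ ℓ ∈ T, (∫ v, ∏ p ∈ C ℓ, w (plaquetteHolonomy (update U ℓ v) p.1 p.2.1.1 p.2.1.2) ∂(haarProbability G)) with hNP
  set ZT : ℝ := ∫ V, FT V ∂Haar with hZT
  set K : ℝ := (∏ ℓ ∈ T, (∫ h, w h ^ (C ℓ).card ∂(haarProbability G)) /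
        (m ^ ((C ℓ).card - 1) * ∫ g, w g ∂(haarProbability G))) with hK
  have hw0 : ∀ g, 0 < w g := fun g => hm0.trans_le (hm g)
  have hMpos : 0 < M := (hw0 1).trans_le (hM 1)
  have hc : 0 < ∫ g, w g ∂(haarProbability G) := haarProbability_integral_pos_of_continuous_pos hw hw0
  haveI : IsProbabilityMeasure Haar := by rw [hHaar]; infer_instance
  have hFTc : Continuous FT := continuous_prodPlaquetteWeight_anyDim hw Finset.univ
  have hFTpos : ∀ U, 0 < FT U := fun U => prod_pos fun p _ => hw0 _
  have hFTi : Integrable FT Haar := by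
    refine Integrable.mono' (integrable_const (M ^ (Finset.univ : Finset (Plaquette d L)).card))
      hFTc.aestronglyMeasurable (ae_of_all _ fun U => ?_)
    rw [Real.norm_eq_abs, abs_of_pos (hFTpos U)]
    exact (pow_le_prodPlaquetteWeight_le_pow_anyDim hm0 hm hM _ U).2
  have hZTpos : 0 < ZT := by
    have h := integral_mono (integrable_const (m ^ (Finset.univ : Finset (Plaquette d L)).card)) hFTi
      fun U => (pow_le_prodPlaquetteWeight_le_pow_anyDim hm0 hm hM _ U).1
    rw [integral_const, smul_eq_mul, probReal_univ, one_mul] at h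
    exact lt_of_lt_of_le (pow_pos hm0 _) h
  -- the normalisers: squeeze and measurability
  have hNlo : ∀ ℓ ∈ T, ∀ U, m ^ ((C ℓ).card - 1) * (∫ g, w g ∂(haarProbability G)) ≤ (∫ v, ∏ p ∈ C ℓ, w (plaquetteHolonomy (update U ℓ v) p.1 p.2.1.1 p.2.1.2) ∂(haarProbability G)) := by
    intro ℓ hℓ U
    obtain ⟨p₀, hp₀⟩ := hCne ℓ hℓ
    exact normaliser_ge hL hw hm0 hm (C ℓ) ℓ hp₀ (hCe ℓ hℓ p₀ hp₀) U
  have hNhi : ∀ ℓ ∈ T, ∀ U, (∫ v, ∏ p ∈ C ℓ, w (plaquetteHolonomy (update U ℓ v) p.1 p.2.1.1 p.2.1.2) ∂(haarProbability G)) ≤ ∫ h, w h ^ (C ℓ).card ∂(haarProbability G) :=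
    fun ℓ hℓ U => integral_update_prod_plaquettes_le hL hw (fun g => (hw0 g).le) U (C ℓ) (hCne ℓ hℓ) (hCe ℓ hℓ)
  have hlopos : ∀ ℓ ∈ T, 0 < m ^ ((C ℓ).card - 1) * (∫ g, w g ∂(haarProbability G)) :=
    fun ℓ _ => mul_pos (pow_pos hm0 _) hc
  have hNPpos : ∀ U, 0 < NP U := fun U =>
    prod_pos fun ℓ hℓ => lt_of_lt_of_le (hlopos ℓ hℓ) (hNlo ℓ hℓ U)
  have hNPm : Measurable NP := Finset.measurable_prod T fun ℓ _ => measurable_normaliser hw (C ℓ) ℓ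
  have hNPlo : ∀ U, ∏ ℓ ∈ T, m ^ ((C ℓ).card - 1) * (∫ g, w g ∂(haarProbability G)) ≤ NP U := fun U =>
    Finset.prod_le_prod (fun ℓ hℓ => (hlopos ℓ hℓ).le) fun ℓ hℓ => hNlo ℓ hℓ U
  have hNPhi : ∀ U, NP U ≤ ∏ ℓ ∈ T, ∫ h, w h ^ (C ℓ).card ∂(haarProbability G) := fun U =>
    Finset.prod_le_prod (fun ℓ hℓ => (lt_of_lt_of_le (hlopos ℓ hℓ) (hNlo ℓ hℓ U)).le) fun ℓ hℓ => hNhi ℓ hℓ U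
  have hLpos : 0 < ∏ ℓ ∈ T, m ^ ((C ℓ).card - 1) * (∫ g, w g ∂(haarProbability G)) :=
    prod_pos fun ℓ hℓ => hlopos ℓ hℓ
  have hKeq : K = (∏ ℓ ∈ T, ∫ h, w h ^ (C ℓ).card ∂(haarProbability G)) /
      ∏ ℓ ∈ T, m ^ ((C ℓ).card - 1) * (∫ g, w g ∂(haarProbability G)) := by
    rw [hK, Finset.prod_div_distrib]
  have hHpos : 0 < ∏ ℓ ∈ T, ∫ h, w h ^ (C ℓ).card ∂(haarProbability G) :=
    prod_pos fun ℓ hℓ => lt_of_lt_of_le (hlopos ℓ hℓ) ((hNlo ℓ hℓ 1).trans (hNhi ℓ hℓ 1))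
  have hKpos : 0 < K := by
    rw [hKeq]
    exact div_pos (prod_pos fun ℓ hℓ => lt_of_lt_of_le (hlopos ℓ hℓ) ((hNlo ℓ hℓ 1).trans (hNhi ℓ hℓ 1))) hLpos
  have hK1 : 1 ≤ K := by
    rw [hKeq, le_div_iff₀ hLpos, one_mul]
    exact (hNPlo 1).trans (hNPhi 1)
  -- the density ratio `ρ = Z/∏N` : `q = ρ · π`
  set ρ : GaugeConfig d L G → ℝ := fun U => ZT / NP U with hρ
  have hρpos : ∀ U, 0 < ρ U := fun U => div_pos hZTpos (hNPpos U)
  have hρm : Measurable ρ := measurable_const.div hNPm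
  have hqdens : ∀ U, (∏ ℓ ∈ T, (∏ p ∈ C ℓ, w (plaquetteHolonomy U p.1 p.2.1.1 p.2.1.2)) /
          (∫ v, ∏ p ∈ C ℓ, w (plaquetteHolonomy (update U ℓ v) p.1 p.2.1.1 p.2.1.2) ∂(haarProbability G))) = FT U / NP U := by
    intro U
    have h := target_div_allClosing_eq hw hm0 hm hM T C hdisj hcover 1 U
    rw [div_one, div_one] at h
    -- `FT / ∏q = NP`, i.e. `∏q = FT / NP`
    have hq0 : (∏ ℓ ∈ T, (∏ p ∈ C ℓ, w (plaquetteHolonomy U p.1 p.2.1.1 p.2.1.2)) /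
          (∫ v, ∏ p ∈ C ℓ, w (plaquetteHolonomy (update U ℓ v) p.1 p.2.1.1 p.2.1.2) ∂(haarProbability G))) ≠ 0 :=
      (prod_pos fun ℓ hℓ => div_pos (prod_pos fun p _ => hw0 _)
        (lt_of_lt_of_le (hlopos ℓ hℓ) (hNlo ℓ hℓ U))).ne'
    rw [div_eq_iff hq0] at h
    rw [eq_div_iff (hNPpos U).ne', mul_comm]
    exact h.symm
  have hρq : q = π.withDensity fun U => ENNReal.ofReal (ρ U) := by
    rw [hq, hπ]
    change Haar.withDensity (fun U => ENNReal.ofReal (∏ ℓ ∈ T, (∏ p ∈ C ℓ, w (plaquetteHolonomy U p.1 p.2.1.1 p.2.1.2)) /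
          (∫ v, ∏ p ∈ C ℓ, w (plaquetteHolonomy (update U ℓ v) p.1 p.2.1.1 p.2.1.2) ∂(haarProbability G)))) =
      (Haar.withDensity fun U => ENNReal.ofReal (FT U / ZT)).withDensity fun U => ENNReal.ofReal (ρ U)
    rw [← withDensity_mul _ (by fun_prop : Measurable fun U => ENNReal.ofReal (FT U / ZT))
      (by exact hρm.ennreal_ofReal)]
    refine withDensity_congr_ae (ae_of_all _ fun U => ?_)
    simp only [Pi.mul_apply]
    rw [← ENNReal.ofReal_mul (div_nonneg (hFTpos U).le hZTpos.le), hqdens U]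
    congr 1
    rw [hρ]
    field_simp [(hNPpos U).ne', hZTpos.ne']
  -- the oscillation bound `ρ U ≤ K ρ V`
  have hosc : ∀ U V, ρ U ≤ Real.exp (Real.log K) * ρ V := by
    intro U V
    rw [Real.exp_log hKpos]
    calc ρ U = ZT / NP U := rfl
      _ ≤ ZT / ∏ ℓ ∈ T, m ^ ((C ℓ).card - 1) * (∫ g, w g ∂(haarProbability G)) :=
          div_le_div_of_nonneg_left hZTpos.le hLpos (hNPlo U)
      _ = K * (ZT / ∏ ℓ ∈ T, ∫ h, w h ^ (C ℓ).card ∂(haarProbability G)) := by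
          rw [hKeq]
          field_simp [hHpos.ne', hLpos.ne']
          exact Finset.prod_congr rfl fun ℓ _ => mul_comm _ _
      _ ≤ K * (ZT / NP V) :=
          mul_le_mul_of_nonneg_left (div_le_div_of_nonneg_left hZTpos.le (hNPpos V) (hNPhi V)) hKpos.le
      _ = K * ρ V := rfl
  have hmain := indepMH_autocorrelation_of_density_ratio (π := π) (q := q) hρm hρpos hρq hosc hf hCf hf0
  obtain ⟨hcov, htau, -⟩ := hmain
  have hexpneg : Real.exp (-Real.log K) = K⁻¹ := by rw [Real.exp_neg, Real.exp_log hKpos]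
  refine ⟨fun t => ?_, ?_⟩
  · have h := hcov t
    rwa [hexpneg] at h
  · rwa [Real.exp_log hKpos] at htau

end Summit.Ventures.LatticeQCDFlow.Theory2.Autoregressive

end
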